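import Literature.MathematicalPhysics.QuantumFieldTheory.Federbush1986.PhaseCellIVGeomConstructions

/-!
# Federbush, *A phase cell approach to Yang–Mills theory. IV. The choice of variables* (CMP **114** (1988) 317–343) —
# §11 Geometric Construction 1, (11.4) p. 337, PROVED (embedded reading) for every COMPACT CONNECTED uniformly
# Lipschitz-retractable target `M ⊆ Rᵗ`

statement-level skeleton of published theorems with citation tags; proofs where landed; nothing here is a claim about the Yang–Mills mass gap

Cell `lit-balaban`, reader/typer block **r19** (F4 fold owner), SKELETON row `F4.Eq11.4` (and inventory row `F4.Def§11`) of
`run/shared/lean/pub/lit-balaban/lit-balaban-r19/ROWS-F4.md`; companion of `PhaseCellIVGeomConstructions` (p264612), where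
`GeomConstruction1 t M` is typed and proved for the spheres `S^{t−1}`, `t ≥ 2` (`geomConstruction1_sphere`, two chords through a
midpoint direction) and where the single retracted chord `exists_shortPath_of_retract` handles end values at distance `< r`.

**Source.** P. Federbush, Commun. Math. Phys. **114** (1988) 317–343 [bib `Federbush1988PhaseCellIV`; doi:10.1007/bf01225039;
lit store `paper:doi-10-1007-bf01225039`; journal page = PDF page + 316], p. 337 [PDF 21] read as an image (render
`lit-balaban-r19/renders/f4/f4-p021.png`).  Verbatim: «*Geometric Construction 1.* We find an extension of `φ′₁(x)`,
`ᵉφ′₁(x)`, to a mapping from `e → G` (a gauge on `e`) such that a) `ᵉφ′₁(v_a)` and `ᵉφ′₁(v_b)` assume given values.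
b) `Λ₁(ᵉφ′₁) ≤ c · d(φ′₁(v_b), φ′₁(v_a))/L_r` (11.4) where `Λ₁(φ) = Sup_{x,y} d(φ(x), φ(y))/|x − y|`, and `c` depends only on the
group (if `φ′₁(v_a)` and `φ′₁(v_b)` are close enough, then they may be joined by a geodesic, and `c` picked equal 1).»

**What this file proves.** `geomConstruction1_of_retract`: `GeomConstruction1 t M` (p264612's typing: ONE constant `c` for
every edge length `ℓ = L_r` and every pair of end values) for every COMPACT, (pre)CONNECTED `M ⊆ Rᵗ` admitting a uniform
Lipschitz neighbourhood retraction (`r > 0`, `P` `L`-Lipschitz on `{dist(·, M) < r}` with values in `M`, `P = id` on `M` — the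
standing hypothesis of the F4 Appendix-A files `PhaseCellIVThmA2Embedded`, `PhaseCellIVThmA1Small/Large`,
`PhaseCellIVGeomConstruction4`), with `c = L·(N_max + 1)`.  Print's «joined by a geodesic» (a path in `M` of length
comparable to the distance of the end values) is realised as follows: near end values (`|g_a − g_b| < r`) by the single
retracted chord (`exists_shortPath_of_retract`, `Λ₁ ≤ L|g_a − g_b|/ℓ`); far end values (`|g_a − g_b| ≥ r`) by a chain
`g_a = c_0, c_1, …, c_N = g_b` in `M` with steps `< r` and `N ≤ N_max` UNIFORM (§1: the relation «joined by an `r`-chain in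
`M`» has open classes, so by connectedness — Mathlib `IsPreconnected.induction₂'` — any two points are chained,
`GeomConstr1.exists_chain`; compactness gives a finite `r/2`-net and hence a uniform length, `exists_uniform_chain`), traced by
the concatenation of the `N` retracted chords, an `L·r`-Lipschitz path `[0, N] → M` (§2, `exists_path_of_chain`, glued by
`GeomConstr.lipschitzOnWith_Icc_of_glue`), rescaled to the edge `[0, ℓ]`: `Λ₁ ≤ L r N/ℓ ≤ L N_max |g_a − g_b|/ℓ`.
Connectedness is necessary for (11.4) as typed (end values in different components cannot be joined in `M`); the gauge groups
of the series (`U(1)`, `SU(2)`) are connected.  Together with p263972/p264612/p266275/p299105 this makes Theorems A.1, A.2 and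
Constructions 1, 2, 3 (= A.1 on the cube), 4 available for every compact connected uniformly Lipschitz-retractable `M`; the
tubular-neighbourhood theorem (compact `C²` submanifold ⇒ such a retraction) is the one un-formalised input (p04 g8 in flight).
-/

namespace Literature.MathematicalPhysics.QuantumFieldTheory.Federbush1986

noncomputable section

open scoped NNReal ENNReal
open Set Metric

namespace PhaseCellIVAppA

namespace GeomConstr1

variable {t : ℕ} {M : Set (EuclideanSpace ℝ (Fin t))} {r : ℝ} {L : ℝ≥0}
  {P : EuclideanSpace ℝ (Fin t) → EuclideanSpace ℝ (Fin t)}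

/-! ## 1. `r`-chains inside `M` (print: «joined by a geodesic» — a path in `M`; discretised) -/

/-- A one-step chain. [cite: Federbush1988PhaseCellIV, (11.4) p. 337] -/
theorem chain_single {x y : EuclideanSpace ℝ (Fin t)} (hx : x ∈ M) (hy : y ∈ M) (hxy : dist x y < r) :
    ∃ (N : ℕ) (c : ℕ → EuclideanSpace ℝ (Fin t)), N ≤ 1 ∧ c 0 = x ∧ c N = y ∧ (∀ i ≤ N, c i ∈ M) ∧
      ∀ i < N, dist (c i) (c (i + 1)) < r := by
  refine ⟨1, fun i => if i = 0 then x else y, le_rfl, by simp, by simp, fun i hi => ?_, fun i hi => ?_⟩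
  · by_cases h : i = 0
    · simp [h, hx]
    · simp [h, hy]
  · have h0 : i = 0 := by omega
    subst h0
    simpa using hxy

/-- Concatenation of chains. [cite: Federbush1988PhaseCellIV, (11.4) p. 337] -/
theorem chain_append {x y z : EuclideanSpace ℝ (Fin t)} {N₁ N₂ : ℕ} {c₁ c₂ : ℕ → EuclideanSpace ℝ (Fin t)}
    (h₁0 : c₁ 0 = x) (h₁N : c₁ N₁ = y) (h₁M : ∀ i ≤ N₁, c₁ i ∈ M) (h₁s : ∀ i < N₁, dist (c₁ i) (c₁ (i + 1)) < r)
    (h₂0 : c₂ 0 = y) (h₂N : c₂ N₂ = z) (h₂M : ∀ i ≤ N₂, c₂ i ∈ M) (h₂s : ∀ i < N₂, dist (c₂ i) (c₂ (i + 1)) < r) :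
    ∃ c : ℕ → EuclideanSpace ℝ (Fin t), c 0 = x ∧ c (N₁ + N₂) = z ∧ (∀ i ≤ N₁ + N₂, c i ∈ M) ∧
      ∀ i < N₁ + N₂, dist (c i) (c (i + 1)) < r := by
  refine ⟨fun i => if i ≤ N₁ then c₁ i else c₂ (i - N₁), by simp [h₁0], ?_, fun i hi => ?_, fun i hi => ?_⟩
  · by_cases h : N₁ + N₂ ≤ N₁
    · have hN₂ : N₂ = 0 := by omega
      simp only [if_pos h]
      rw [show N₁ + N₂ = N₁ by omega, h₁N, ← h₂0, ← hN₂, h₂N]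
    · simp only [if_neg h]
      rw [show N₁ + N₂ - N₁ = N₂ by omega, h₂N]
  · by_cases h : i ≤ N₁
    · simp only [if_pos h]; exact h₁M i h
    · simp only [if_neg h]; exact h₂M _ (by omega)
  · by_cases h : i + 1 ≤ N₁
    · simp only [if_pos h, if_pos (show i ≤ N₁ by omega)]
      exact h₁s i (by omega)
    · by_cases h' : i ≤ N₁
      · have hi1 : i = N₁ := by omega
        subst hi1
        simp only [if_pos le_rfl, if_neg h, h₁N, show i + 1 - i = 0 + 1 by omega]
        rw [← h₂0]
        exact h₂s 0 (by omega)
      · simp only [if_neg h', if_neg h, show i + 1 - N₁ = (i - N₁) + 1 by omega]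
        exact h₂s _ (by omega)

/-- **Any two points of a preconnected `M` are joined by an `r`-chain inside `M`** (the relation «joined by a finite chain of
steps `< r` in `M`» is reflexive-transitive with open classes; Mathlib `IsPreconnected.induction₂'`).
[cite: Federbush1988PhaseCellIV, (11.4) p. 337] -/
theorem exists_chain (hM : IsPreconnected M) (hr : 0 < r) {x y : EuclideanSpace ℝ (Fin t)} (hx : x ∈ M) (hy : y ∈ M) :
    ∃ (N : ℕ) (c : ℕ → EuclideanSpace ℝ (Fin t)), c 0 = x ∧ c N = y ∧ (∀ i ≤ N, c i ∈ M) ∧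
      ∀ i < N, dist (c i) (c (i + 1)) < r := by
  refine hM.induction₂' (fun x y => ∃ (N : ℕ) (c : ℕ → EuclideanSpace ℝ (Fin t)), c 0 = x ∧ c N = y ∧
      (∀ i ≤ N, c i ∈ M) ∧ ∀ i < N, dist (c i) (c (i + 1)) < r) (fun a ha => ?_) (fun a b d ha hb hd hab hbd => ?_) hx hy
  · filter_upwards [mem_nhdsWithin_of_mem_nhds (ball_mem_nhds a hr), self_mem_nhdsWithin] with b hb hbM
    rw [mem_ball] at hb
    obtain ⟨N, c, -, hc⟩ := chain_single ha hbM (by rwa [dist_comm] at hb)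
    obtain ⟨N', c', -, hc'⟩ := chain_single hbM ha hb
    exact ⟨⟨N, c, hc⟩, ⟨N', c', hc'⟩⟩
  · obtain ⟨N₁, c₁, h₁0, h₁N, h₁M, h₁s⟩ := hab
    obtain ⟨N₂, c₂, h₂0, h₂N, h₂M, h₂s⟩ := hbd
    obtain ⟨c, hc⟩ := chain_append h₁0 h₁N h₁M h₁s h₂0 h₂N h₂M h₂s
    exact ⟨N₁ + N₂, c, hc⟩

/-- **Uniform chain length** for a COMPACT preconnected `M`: there is `N_max` such that any two points of `M` are joined by an
`r`-chain in `M` with at most `N_max` steps (finite `r/2`-net of `M`; chains between the finitely many net points; one step in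
and one step out). [cite: Federbush1988PhaseCellIV, (11.4) p. 337] -/
theorem exists_uniform_chain (hMc : IsCompact M) (hM : IsPreconnected M) (hr : 0 < r) :
    ∃ Nmax : ℕ, ∀ x ∈ M, ∀ y ∈ M, ∃ (N : ℕ) (c : ℕ → EuclideanSpace ℝ (Fin t)), N ≤ Nmax ∧ c 0 = x ∧ c N = y ∧
      (∀ i ≤ N, c i ∈ M) ∧ ∀ i < N, dist (c i) (c (i + 1)) < r := by
  classical
  obtain ⟨net, hnetM, hfin, hcover⟩ := finite_cover_balls_of_compact hMc (half_pos hr)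
  haveI : Fintype ↥net := hfin.fintype
  have hpair : ∀ p : ↥net × ↥net, ∃ (N : ℕ) (c : ℕ → EuclideanSpace ℝ (Fin t)), c 0 = p.1 ∧ c N = p.2 ∧
      (∀ i ≤ N, c i ∈ M) ∧ ∀ i < N, dist (c i) (c (i + 1)) < r := fun p =>
    exists_chain hM hr (hnetM p.1.2) (hnetM p.2.2)
  choose Nf cf hcf using hpair
  refine ⟨Finset.univ.sup Nf + 2, fun x hx y hy => ?_⟩
  obtain ⟨a, ha, hxa⟩ := mem_iUnion₂.mp (hcover hx)
  obtain ⟨b, hb, hyb⟩ := mem_iUnion₂.mp (hcover hy)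
  rw [mem_ball] at hxa hyb
  have hxa' : dist x a < r := by linarith
  have hby' : dist b y < r := by rw [dist_comm]; linarith
  -- `x → a → b → y`
  obtain ⟨N₁, c₁, hN₁, h₁0, h₁N, h₁M, h₁s⟩ := chain_single hx (hnetM ha) hxa'
  obtain ⟨h₂0, h₂N, h₂M, h₂s⟩ := hcf (⟨a, ha⟩, ⟨b, hb⟩)
  obtain ⟨N₃, c₃, hN₃, h₃0, h₃N, h₃M, h₃s⟩ := chain_single (hnetM hb) hy hby'
  obtain ⟨c₁₂, h0, hN, hMm, hs⟩ := chain_append h₁0 h₁N h₁M h₁s h₂0 h₂N h₂M h₂s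
  obtain ⟨c, hc0, hcN, hcM, hcs⟩ := chain_append h0 hN hMm hs h₃0 h₃N h₃M h₃s
  refine ⟨N₁ + Nf (⟨a, ha⟩, ⟨b, hb⟩) + N₃, c, ?_, hc0, hcN, hcM, hcs⟩
  have : Nf (⟨a, ha⟩, ⟨b, hb⟩) ≤ Finset.univ.sup Nf := Finset.le_sup (Finset.mem_univ _)
  omega

/-! ## 2. From an `r`-chain to a Lipschitz path: concatenated retracted chords -/

/-- The retracted chord between two points of `M` at distance `< r` stays in the tube and is `L·|p − q|`-Lipschitz in the
parameter. [cite: Federbush1988PhaseCellIV, (11.4) p. 337] -/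
theorem chord_facts (hPL : LipschitzOnWith L P {y | infDist y M < r}) (hPM : MapsTo P {y | infDist y M < r} M)
    {p q : EuclideanSpace ℝ (Fin t)} (hp : p ∈ M) (hpq : dist p q < r) :
    (∀ τ ∈ Icc (0 : ℝ) 1, P (p + τ • (q - p)) ∈ M) ∧
      LipschitzOnWith (L * ‖q - p‖₊) (fun τ : ℝ => P (p + τ • (q - p))) (Icc 0 1) := by
  have hU : ∀ τ ∈ Icc (0 : ℝ) 1, p + τ • (q - p) ∈ {y | infDist y M < r} := by
    intro τ hτ
    show infDist (p + τ • (q - p)) M < r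
    calc infDist (p + τ • (q - p)) M ≤ dist (p + τ • (q - p)) p := infDist_le_dist_of_mem hp
      _ = τ * dist p q := by
          rw [dist_eq_norm, add_sub_cancel_left, norm_smul, Real.norm_of_nonneg hτ.1, dist_eq_norm, norm_sub_rev]
      _ ≤ 1 * dist p q := by gcongr; exact hτ.2
      _ < r := by rwa [one_mul]
  refine ⟨fun τ hτ => hPM (hU τ hτ), LipschitzOnWith.of_dist_le_mul fun τ hτ τ' hτ' => ?_⟩
  calc dist (P (p + τ • (q - p))) (P (p + τ' • (q - p))) ≤ L * dist (p + τ • (q - p)) (p + τ' • (q - p)) :=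
        hPL.dist_le_mul _ (hU τ hτ) _ (hU τ' hτ')
    _ = (L * ‖q - p‖₊ : ℝ≥0) * dist τ τ' := by
        rw [dist_eq_norm, show p + τ • (q - p) - (p + τ' • (q - p)) = (τ - τ') • (q - p) by rw [sub_smul]; abel,
          norm_smul, Real.norm_eq_abs, ← Real.dist_eq]
        push_cast
        ring

/-- **An `r`-chain of `N` steps in `M` is traced by an `L·r`-Lipschitz path `[0, N] → M`** (unit time per step: the retracted
chords glued at the chain points). [cite: Federbush1988PhaseCellIV, (11.4) p. 337] -/
theorem exists_path_of_chain (hr : 0 < r) (hPL : LipschitzOnWith L P {y | infDist y M < r})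
    (hPM : MapsTo P {y | infDist y M < r} M) (hPid : ∀ y ∈ M, P y = y) (c : ℕ → EuclideanSpace ℝ (Fin t)) :
    ∀ N : ℕ, (∀ i ≤ N, c i ∈ M) → (∀ i < N, dist (c i) (c (i + 1)) < r) →
      ∃ ψ : ℝ → EuclideanSpace ℝ (Fin t), ψ 0 = c 0 ∧ ψ N = c N ∧ (∀ s ∈ Icc (0 : ℝ) N, ψ s ∈ M) ∧
        LipschitzOnWith (L * ⟨r, hr.le⟩) ψ (Icc (0 : ℝ) N) := by
  intro N
  induction N with
  | zero =>
    intro hcM _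
    refine ⟨fun _ => c 0, rfl, by simp, fun s _ => hcM 0 le_rfl, ?_⟩
    exact LipschitzOnWith.of_dist_le_mul fun s _ s' _ => by rw [dist_self]; positivity
  | succ N ih =>
    intro hcM hstep
    obtain ⟨ψ₀, h0, hN, hM0, hL0⟩ := ih (fun i hi => hcM i (by omega)) (fun i hi => hstep i (by omega))
    have hcN : c N ∈ M := hcM N (by omega)
    have hcN1 : c (N + 1) ∈ M := hcM (N + 1) le_rfl
    have hd : dist (c N) (c (N + 1)) < r := hstep N (by omega)
    obtain ⟨hχM, hχL⟩ := chord_facts hPL hPM hcN hd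
    set χ : ℝ → EuclideanSpace ℝ (Fin t) := fun τ => P (c N + τ • (c (N + 1) - c N)) with hχ
    refine ⟨fun s => if s ≤ (N : ℝ) then ψ₀ s else χ (s - N), ?_, ?_, fun s hs => ?_, ?_⟩
    · simp only [Nat.cast_nonneg, if_true]; exact h0
    · have h : ¬ ((N + 1 : ℕ) : ℝ) ≤ (N : ℝ) := by push_cast; linarith
      simp only [h, if_false]
      rw [hχ]
      simp only
      rw [show ((N + 1 : ℕ) : ℝ) - N = 1 by push_cast; ring, one_smul, add_sub_cancel, hPid _ hcN1]
    · by_cases h : s ≤ (N : ℝ)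
      · simp only [h, if_true]; exact hM0 s ⟨hs.1, h⟩
      · simp only [h, if_false]
        push Not at h
        refine hχM (s - N) ⟨by linarith, ?_⟩
        have := hs.2; push_cast at this; linarith
    · have hcast : ((N + 1 : ℕ) : ℝ) = (N : ℝ) + 1 := by push_cast; ring
      rw [hcast]
      refine GeomConstr.lipschitzOnWith_Icc_of_glue (b := (N : ℝ)) ?_ ?_
      · refine LipschitzOnWith.of_dist_le_mul fun s hs s' hs' => ?_
        simp only [hs.2, hs'.2, if_true]
        exact hL0.dist_le_mul s hs s' hs'
      · have hψN : ∀ s ∈ Icc (N : ℝ) (N + 1), (if s ≤ (N : ℝ) then ψ₀ s else χ (s - N)) = χ (s - N) := by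
          intro s hs
          by_cases h : s ≤ (N : ℝ)
          · have hsN : s = N := le_antisymm h hs.1
            simp only [h, if_true]
            rw [hsN, hN, hχ]
            simp only [sub_self, zero_smul, add_zero]
            exact (hPid _ hcN).symm
          · simp only [h, if_false]
        refine LipschitzOnWith.of_dist_le_mul fun s hs s' hs' => ?_
        rw [hψN s hs, hψN s' hs']
        have h1 : s - N ∈ Icc (0 : ℝ) 1 := ⟨by linarith [hs.1], by linarith [hs.2]⟩
        have h2 : s' - N ∈ Icc (0 : ℝ) 1 := ⟨by linarith [hs'.1], by linarith [hs'.2]⟩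
        calc dist (χ (s - N)) (χ (s' - N)) ≤ (L * ‖c (N + 1) - c N‖₊ : ℝ≥0) * dist (s - N) (s' - N) :=
              hχL.dist_le_mul _ h1 _ h2
          _ ≤ (L * ⟨r, hr.le⟩ : ℝ≥0) * dist s s' := by
              rw [show dist (s - (N : ℝ)) (s' - N) = dist s s' by rw [Real.dist_eq, Real.dist_eq]; ring_nf]
              gcongr
              show ‖c (N + 1) - c N‖ ≤ r
              rw [← dist_eq_norm, dist_comm]; exact hd.le

end GeomConstr1

/-! ## 3. Geometric Construction 1 (11.4) for every compact connected uniformly Lipschitz-retractable `M` -/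

open GeomConstr1 in
/-- **Geometric Construction 1, (11.4), PROVED for every COMPACT (pre)CONNECTED uniformly Lipschitz-retractable `M ⊆ Rᵗ`**
(`P` an `L`-Lipschitz retraction of the open `r`-neighbourhood onto `M`), with `c = L·(N_max + 1)`, `N_max` the uniform
`r`-chain length of `M`: print's «joined by a geodesic» is realised, for end values at distance `< r`, by ONE retracted chord
(`exists_shortPath_of_retract`: `Λ₁ ≤ L·|g_a − g_b|/ℓ`, «c picked equal 1» up to `L`), and for end values at distance `≥ r` by
the concatenation of `≤ N_max` retracted chords along an `r`-chain in `M` (`Λ₁ ≤ L·r·N_max/ℓ ≤ L·N_max·|g_a − g_b|/ℓ`).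
Connectedness is necessary for the statement as typed (end values in different components of `M` cannot be joined); the
spheres `S^{t−1}`, `t ≥ 2`, were done directly in `geomConstruction1_sphere` (p264612, `c = 6`).
[cite: Federbush1988PhaseCellIV, Geometric Construction 1 (11.4) p. 337] -/
theorem geomConstruction1_of_retract {t : ℕ} {M : Set (EuclideanSpace ℝ (Fin t))} {r : ℝ} {L : ℝ≥0}
    {P : EuclideanSpace ℝ (Fin t) → EuclideanSpace ℝ (Fin t)} (hMc : IsCompact M) (hM : IsPreconnected M) (hr : 0 < r)
    (hPL : LipschitzOnWith L P {y | infDist y M < r}) (hPM : MapsTo P {y | infDist y M < r} M) (hPid : ∀ y ∈ M, P y = y) :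
    GeomConstruction1 t M := by
  classical
  obtain ⟨Nmax, hchain⟩ := exists_uniform_chain hMc hM hr
  refine ⟨L * (Nmax + 1), fun ℓ hℓ ga gb => ?_⟩
  by_cases hd : dist ga gb < r
  · -- near end values: one retracted chord
    obtain ⟨φ, h0, h1, hΛ⟩ := exists_shortPath_of_retract hPL hPM hPid hℓ ga gb hd
    refine ⟨φ, h0, h1, hΛ.trans ?_⟩
    gcongr
    exact_mod_cast le_mul_of_one_le_right L.2 (by simp)
  · -- far end values: a chain of at most `N_max` chords
    push Not at hd
    obtain ⟨N, c, hNle, hc0, hcN, hcM, hcs⟩ := hchain _ ga.2 _ gb.2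
    obtain ⟨ψ, hψ0, hψN, hψM, hψL⟩ := exists_path_of_chain hr hPL hPM hPid c N hcM hcs
    -- rescale `[0, ℓ] → [0, N]`
    have hsc : ∀ s : ↥(Icc (0 : ℝ) ℓ), (N : ℝ) * s.1 / ℓ ∈ Icc (0 : ℝ) N := fun s =>
      ⟨by have := s.2.1; positivity, by
        rw [div_le_iff₀ hℓ]; exact mul_le_mul_of_nonneg_left s.2.2 (Nat.cast_nonneg N)⟩
    refine ⟨fun s => ⟨ψ (N * s.1 / ℓ), hψM _ (hsc s)⟩, ?_, ?_, ?_⟩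
    · apply Subtype.ext
      show ψ (N * 0 / ℓ) = ga
      rw [mul_zero, zero_div, hψ0, hc0]
    · apply Subtype.ext
      show ψ (N * ℓ / ℓ) = gb
      rw [mul_div_assoc, div_self hℓ.ne', mul_one, hψN, hcN]
    · set ℓ' : ℝ≥0 := Real.toNNReal ℓ with hℓ'
      have hℓ'pos : ℓ' ≠ 0 := by rw [hℓ']; exact (Real.toNNReal_pos.mpr hℓ).ne'
      have hℓ'coe : (ℓ' : ℝ) = ℓ := Real.coe_toNNReal _ hℓ.le
      set R : ℝ≥0 := ⟨r, hr.le⟩ with hR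
      have hφ : LipschitzWith (L * R * N * ℓ'⁻¹)
          (fun s : ↥(Icc (0 : ℝ) ℓ) => (⟨ψ (N * s.1 / ℓ), hψM _ (hsc s)⟩ : ↥M)) := by
        refine LipschitzWith.of_dist_le_mul fun s s' => ?_
        rw [Subtype.dist_eq, Subtype.dist_eq s]
        calc dist (ψ (N * s.1 / ℓ)) (ψ (N * s'.1 / ℓ)) ≤ (L * R : ℝ≥0) * dist ((N : ℝ) * s.1 / ℓ) (N * s'.1 / ℓ) :=
              hψL.dist_le_mul _ (hsc s) _ (hsc s')
          _ = (L * R * N * ℓ'⁻¹ : ℝ≥0) * dist s.1 s'.1 := by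
              rw [Real.dist_eq, Real.dist_eq, ← sub_div, ← mul_sub, abs_div, abs_mul, abs_of_pos hℓ,
                Nat.abs_cast]
              push_cast
              rw [hℓ'coe]
              field_simp
      calc lipConst _ ≤ ((L * R * N * ℓ'⁻¹ : ℝ≥0) : ℝ≥0∞) := lipConst_le_of_lipschitzWith hφ
        _ ≤ ((L * (Nmax + 1) * nndist ga gb * ℓ'⁻¹ : ℝ≥0) : ℝ≥0∞) := by
            gcongr ((?_ : ℝ≥0) : ℝ≥0∞)
            have h1 : R ≤ nndist ga gb := by
              rw [← NNReal.coe_le_coe, coe_nndist]; exact hd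
            have h2 : (N : ℝ≥0) ≤ Nmax + 1 := by exact_mod_cast Nat.le_succ_of_le hNle
            calc L * R * N * ℓ'⁻¹ = L * N * R * ℓ'⁻¹ := by ring
              _ ≤ L * (Nmax + 1) * nndist ga gb * ℓ'⁻¹ := by gcongr
        _ = (L * (Nmax + 1) : ℝ≥0) * edist ga gb / ENNReal.ofReal ℓ := by
            rw [edist_nndist, show ENNReal.ofReal ℓ = (ℓ' : ℝ≥0∞) from rfl, div_eq_mul_inv, ← ENNReal.coe_inv hℓ'pos]
            push_cast
            ring

end PhaseCellIVAppA

end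

end Literature.MathematicalPhysics.QuantumFieldTheory.Federbush1986
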